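import Summits.FinalStateConjecture.FinalStateConjecture.Theses.DissipativeFinalMotions
import Summits.FinalStateConjecture.FinalStateConjecture.Theorems.DissipativeFinalMotionsDispersingCaptureStubCaptureOfSettled
import HarnessLib

/-!
# PROPOSED RESTATEMENT (rev 4) of crux stmt-FinalStateConjecture-17643 `DispersingCapture` — lead prover c3, 2026-08-17
# (crux workfile `Restatement_c3.lean`; SUPERSEDES `Restatement_c2.lean`, whose `DispersingCapture₄/₄′` are VACUOUS for `N ≥ 1`)

Why c2's proposal must not be adopted: `DispersingCapture₄′` adds `IsRestFrameSettled … B₀ … Ψ₀ …` — full-slab `C²`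
flatness of the package's OWN flat chart on `U₀` — next to the package, whose clause (F2) forces
`U₀ ⊇ {t > T, distᵢ > ρ₀}` with a CONSTANT `ρ₀`; with (X3), (X4), dispersal and the honest radii this is
contradictory for `N ≥ 1` (a point at flat distance `ρ₀ + 1` from a hole is hole-charted at bounded Kerr–Schild
radius, where the complex quadratic Weyl invariant tends to Kerr's non-zero value, and flat-charted where the same
scalar tends to `0`; `Lines/birth-c3.md` §2). So `DispersingCapture₄′` holds vacuously for `N ≥ 1`, and moving the
same-chart predicate into `FinalEraGeneric` would make that item false for every datum forming a black hole.

The repair keeps the fresh binders of the line's stub B₁: a restart time `T₁`, tube profile `ρ`, radii `R`, a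
THINNED flat domain `U₁` and a flat chart `Φ₀` on it (intended `Ψ₀|U₁`), bundled as the landed Literature predicate
`CauchyDevelopment.IsRestFrameSettledOn 𝒟 N M a T₁ ξ B Ψ O U₁ Φ₀ ρ R` (p154854; ten clauses C0, C1, S1–S5, O1, S6,
S7). In THIS workfile the predicate is a namespace-local copy with the same body (farm builds of `Literature` lag
behind p154854 at the time of writing); the crux signature should use the Literature name. Three candidate signatures, each pasteable as the crux signature (rev-3 prefix kept; (F₀) dropped in ₅/₅c — subsumed
by S7 — and kept in ₅e):

* `DispersingCapture₅`  — … → `IsRestFrameSettledOn …` → (R) → (F) → dispersal → ESCAPE RATES → conclusion.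
  PROVED: `dispersingCapture₅_holds` (by the landed C `stub_captureOfSettled`, p154603). E (escape rates from the
  package: momentum balance for `N ≥ 2`) then becomes its own conjecture-level item.
* `DispersingCapture₅c` — … → `IsRestFrameSettledOn …` → (R) → (F) → dispersal → CESÀRO VELOCITIES → conclusion.
  PROVED: `dispersingCapture₅c_holds` (by `captureOfSettled_of_cesaro`, p154603). No GR input at all.
* `DispersingCapture₅e` — … → `IsRestFrameSettledOn …` → (R) → (F) → far (F₀) → dispersal → conclusion (neither
  rates nor velocities; the rev-3 far (F₀) on `Ψ₀` is KEPT because E consumes it). Holds MODULO E: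
  `dispersingCapture₅e_of_escapeRate : Sig.stub_escapeRate → DispersingCapture₅e`.

In every case `FinalEraGeneric`'s existential should carry `∃ T₁ ρ R U₁ Φ₀, IsRestFrameSettledOn …` (NOT
`IsRestFrameSettled`) — physics it asserts anyway — and, for ₅/₅c, the rates resp. velocities.
-/

set_option linter.dupNamespace false

noncomputable section

open scoped Manifold ContDiff Topology
open Filter Set Function MeasureTheory Literature.Geometry.Lorentzian

namespace Summit.FinalStateConjecture.FinalStateConjecture.Cruxes.DispersingCapture.Restated3

open Summit.FinalStateConjecture.FinalStateConjecture.Theorems.DissipativeFinalMotions.DispersingCapture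
  (stub_captureOfSettled captureOfSettled_of_cesaro)

/-- LOCAL COPY (same body, token for token) of the landed Literature predicate
`Literature.Geometry.Lorentzian.CauchyDevelopment.IsRestFrameSettledOn` (FinalEraRestFrameSettling.lean, p154854),
kept namespace-local so that this workfile elaborates on farm nodes whose `Literature` build predates p154854. THE
CRUX SIGNATURE SHOULD USE THE LITERATURE NAME (`𝒟.toCauchyDevelopment.IsRestFrameSettledOn N M a T₁ ξ B Ψ O U₁ Φ₀ ρ R`). -/
def IsRestFrameSettledOn
    {X : Type} [TopologicalSpace X] [ChartedSpace E3 X] [IsManifold (𝓡 3) ∞ X] [ConnectedSpace X]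
    {D : InitialDataSet (𝓡 3) X} (𝒟 : CauchyDevelopment D) (N : ℕ) (M a : Fin N → ℝ)
    (T₁ : ℝ) (ξ : Fin N → ℝ → E3) (B : Fin N → ModelBackground)
    (Ψ : (i : Fin N) → (B i).domain → 𝒟.carrier) (O : Set 𝒟.carrier) (U₁ : TopologicalSpace.Opens E4)
    (Φ₀ : (Minkowski.backgroundOn U₁).domain → 𝒟.carrier) (ρ : ℝ → ℝ) (R : Fin N → ℝ → ℝ) : Prop :=
  𝒟.toSpacetime.IsLateChart (Minkowski.backgroundOn U₁) O T₁ Φ₀ ∧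
  (∀ i, 𝒟.toSpacetime.IsLateChart (B i) O T₁ (Ψ i)) ∧
  Tendsto (fun t ↦ ρ t / t) atTop (𝓝 0) ∧
  {y : E4 | T₁ < y 0 ∧ ∀ i, ρ (y 0) < ‖E4.spatial y - ξ i (y 0)‖} ⊆ (U₁ : Set E4) ∧
  Tendsto (fun τ ↦ 𝒟.toSpacetime.deviationCk (Minkowski.backgroundOn U₁) Φ₀ 2 τ) atTop (𝓝 0) ∧
  (∀ i, Tendsto (R i) atTop atTop ∧ ∀ τ, max (Kerr.rPlus (M i) (a i)) 0 + 1 ≤ R i τ) ∧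
  (∀ i, Tendsto (fun τ ↦ 𝒟.toSpacetime.truncDeviationCk (B i) (Ψ i) 2 (R i τ) τ) atTop (𝓝 0)) ∧
  O = 𝒟.metric.causalFuture 𝒟.timeOrientation (range 𝒟.embed) ∩
    𝒟.metric.chronologicalPast 𝒟.timeOrientation
      (Φ₀ '' (Minkowski.backgroundOn U₁).lateRegion T₁ ∪ ⋃ i, Ψ i '' (B i).lateRegion T₁) ∧
  (∀ τ₁, T₁ < τ₁ → O \ (Φ₀ '' (Minkowski.backgroundOn U₁).lateRegion τ₁ ∪
      ⋃ i, Ψ i '' {x : (B i).domain | τ₁ < (B i).time x.1 ∧ (B i).radius x.1 ≤ R i ((B i).time x.1)}) ⊆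
    𝒟.toSpacetime.metric.causalPast 𝒟.toSpacetime.timeOrientation
      (Φ₀ '' (Minkowski.backgroundOn U₁).timeSlab τ₁ ∪ ⋃ i, Ψ i '' (B i).truncTimeSlab (R i τ₁) τ₁)) ∧
  (∀ᶠ τ in atTop, ∀ x ∈ (Minkowski.backgroundOn U₁).timeSlab τ,
    𝒟.toSpacetime.timeOrientation.IsFutureDirected (mfderiv 𝓘(ℝ, E4) (𝓡 4) Φ₀ x (E4.basisVector 0)))

/-- Statement of the GR input E (`stub_escapeRate`, registered stub of the line; rev-3 hypotheses). -/
def Sig.stub_escapeRate : Prop :=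
  open scoped Manifold Topology in ∀ (X : Type) [TopologicalSpace X] [ChartedSpace (EuclideanSpace ℝ (Fin 3)) X] [IsManifold (𝓡 3) ((⊤ : ℕ∞) : WithTop ℕ∞) X] [T2Space X] [SecondCountableTopology X] [ConnectedSpace X], ∀ (D : Literature.Geometry.Lorentzian.InitialDataSet (𝓡 3) X), D ∈ Literature.Geometry.Lorentzian.admissibleVacuumData X → ∀ (𝒟 : Literature.Geometry.Lorentzian.VacuumCauchyDevelopment D), 𝒟.IsMaximal → Summit.FinalStateConjecture.HasCompleteNullInfinity 𝒟.toCauchyDevelopment → ∀ (N : ℕ) (M a : Fin N → ℝ) (T δ V C₁ C₂ ρ₀ κ : ℝ) (ξ : Fin N → ℝ → EuclideanSpace ℝ (Fin 3)) (β : ℝ → ℝ) (U₀ : TopologicalSpace.Opens Literature.Geometry.Lorentzian.E4) (B₀ : Literature.Geometry.Lorentzian.ModelBackground) (B : Fin N → Literature.Geometry.Lorentzian.ModelBackground) (Ψ₀ : B₀.domain → 𝒟.carrier) (Ψ : (i : Fin N) → (B i).domain → 𝒟.carrier) (O : Set 𝒟.carrier), 𝒟.toCauchyDevelopment.IsFinalEra₂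 N M a T δ V C₁ C₂ ρ₀ κ ξ β U₀ B₀ B Ψ₀ Ψ O → Summit.FinalStateConjecture.RaysStayInClosure 𝒟.toCauchyDevelopment O → (∀ i (ρ : ℝ), ∀ᶠ τ in Filter.atTop, ∀ x ∈ (B i).truncTimeSlab ρ τ, 𝒟.toSpacetime.timeOrientation.IsFutureDirected (mfderiv 𝓘(ℝ, Literature.Geometry.Lorentzian.E4) (𝓡 4) (Ψ i) x (Literature.Geometry.Lorentzian.Kerr.timeVector (M i) (a i) x.1))) → (∃ ϱ₀ : ℝ, ∀ᶠ τ in Filter.atTop, ∀ x ∈ B₀.timeSlab τ, (∀ i, ϱ₀ ≤ ‖Literature.Geometry.Lorentzian.E4.spatial x.1 - ξ i τ‖) → 𝒟.toSpacetime.timeOrientation.IsFutureDirected (mfderiv 𝓘(ℝ, Literature.Geometry.Lorentzian.E4) (𝓡 4) Ψ₀ x (Literature.Geometry.Lorentzian.E4.basisVector 0))) → (∀ i j, i ≠ j → Filter.Tendsto (fun t ↦ ‖ξ i t - ξ j t‖) Filter.atTop Filter.atTop) → ∀ i j, i ≠ j → MeasureTheory.IntegrableOn (fun t ↦ 1 /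 ‖ξ i t - ξ j t‖ ^ 2) (Set.Ici T)

/-- **PROPOSED rev 4 (escape-rate form).** Rev 3 with binders `T₁ ρ R U₁ Φ₀` appended, `IsRestFrameSettledOn …`
inserted after the package, (F₀) dropped, and the integrable escape rates as the last hypothesis. -/
def DispersingCapture₅ : Prop :=
  ∀ (X : Type) [TopologicalSpace X] [ChartedSpace (EuclideanSpace ℝ (Fin 3)) X] [IsManifold (𝓡 3) ((⊤ : ℕ∞) : WithTop ℕ∞) X] [T2Space X] [SecondCountableTopology X] [ConnectedSpace X], ∀ (D : Literature.Geometry.Lorentzian.InitialDataSet (𝓡 3) X), D ∈ Literature.Geometry.Lorentzian.admissibleVacuumData X → ∀ (𝒟 : Literature.Geometry.Lorentzian.VacuumCauchyDevelopment D), 𝒟.IsMaximal → Summit.FinalStateConjecture.HasCompleteNullInfinity 𝒟.toCauchyDevelopment → ∀ (N : ℕ) (M a : Fin N → ℝ) (T δ V C₁ C₂ ρ₀ κ : ℝ) (ξ : Fin N → ℝ → EuclideanSpace ℝ (Fin 3)) (β : ℝ → ℝ) (U₀ : TopologicalSpace.Opens Literature.Geometry.Lorentzian.E4) (B₀ : Literature.Geometry.Lorentzian.ModelBackground)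 (B : Fin N → Literature.Geometry.Lorentzian.ModelBackground) (Ψ₀ : B₀.domain → 𝒟.carrier) (Ψ : (i : Fin N) → (B i).domain → 𝒟.carrier) (O : Set 𝒟.carrier) (T₁ : ℝ) (ρ : ℝ → ℝ) (R : Fin N → ℝ → ℝ) (U₁ : TopologicalSpace.Opens Literature.Geometry.Lorentzian.E4) (Φ₀ : (Literature.Geometry.Lorentzian.Minkowski.backgroundOn U₁).domain → 𝒟.carrier), 𝒟.toCauchyDevelopment.IsFinalEra₂ N M a T δ V C₁ C₂ ρ₀ κ ξ β U₀ B₀ B Ψ₀ Ψ O → IsRestFrameSettledOn 𝒟.toCauchyDevelopment N M a T₁ ξ B Ψ O U₁ Φ₀ ρ R → Summit.FinalStateConjecture.RaysStayInClosure 𝒟.toCauchyDevelopment O → (∀ i (ρ' : ℝ), ∀ᶠ τ in Filter.atTop, ∀ x ∈ (B i).truncTimeSlab ρ' τ, 𝒟.toSpacetime.timeOrientation.IsFutureDirected (mfderiv 𝓘(ℝ, Literature.Geometry.Lorentzian.E4) (𝓡 4) (Ψ i) x (Literature.Geometry.Lorentzian.Kerr.timeVector (M i) (a i) x.1))) → (∀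 i j, i ≠ j → Filter.Tendsto (fun t ↦ ‖ξ i t - ξ j t‖) Filter.atTop Filter.atTop) → (∀ i j, i ≠ j → MeasureTheory.IntegrableOn (fun t ↦ 1 / ‖ξ i t - ξ j t‖ ^ 2) (Set.Ici T)) → ∃ (O' : Set 𝒟.carrier) (d : Literature.Geometry.Lorentzian.FinalStateDecomposition 𝒟.toSpacetime O' 2), (∀ i, Literature.Geometry.Lorentzian.Kerr.IsSubextremal (d.mass i) (d.spin i)) ∧ O' = Summit.FinalStateConjecture.exteriorOf 𝒟.toCauchyDevelopment d.charted ∧ Summit.FinalStateConjecture.RaysStayInClosure 𝒟.toCauchyDevelopment O' ∧ Summit.FinalStateConjecture.HasExhaustiveCharts d ∧ Summit.FinalStateConjecture.IsFutureOriented d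

/-- `DispersingCapture₅` HOLDS (landed C `stub_captureOfSettled`, p154603; admissibility, maximality, `𝓘⁺` unused). -/
theorem dispersingCapture₅_holds : DispersingCapture₅ := by
  intro X _ _ _ _ _ _ D _hD 𝒟 _hmax _hscri N M a T δ V C₁ C₂ ρ₀ κ ξ β U₀ B₀ B Ψ₀ Ψ O T₁ ρ R U₁ Φ₀ hera hset hrays
    hholes hdisp hesc
  obtain ⟨hΦ₀, hΨ, hS1, hS2, hS3, hS4, hS5, hO, hS6, hS7⟩ := hset
  exact stub_captureOfSettled X D 𝒟 N M a T δ V C₁ C₂ ρ₀ κ ξ β U₀ B₀ B Ψ₀ Ψ O T₁ ρ R U₁ Φ₀ hera hΦ₀ hΨ hS1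
    hS2 hS3 hS4 hS5 hO hS6 hS7 hrays hholes hdisp hesc

/-- **PROPOSED rev 4 (Cesàro form).** As `DispersingCapture₅` with the escape rates replaced by Cesàro velocities
`t⁻¹ ξᵢ(t) → vᵢ`, `‖vᵢ‖ ≤ V`. -/
def DispersingCapture₅c : Prop :=
  ∀ (X : Type) [TopologicalSpace X] [ChartedSpace (EuclideanSpace ℝ (Fin 3)) X] [IsManifold (𝓡 3) ((⊤ : ℕ∞) : WithTop ℕ∞) X] [T2Space X] [SecondCountableTopology X] [ConnectedSpace X], ∀ (D : Literature.Geometry.Lorentzian.InitialDataSet (𝓡 3) X), D ∈ Literature.Geometry.Lorentzian.admissibleVacuumData X → ∀ (𝒟 : Literature.Geometry.Lorentzian.VacuumCauchyDevelopment D), 𝒟.IsMaximal → Summit.FinalStateConjecture.HasCompleteNullInfinity 𝒟.toCauchyDevelopment → ∀ (N : ℕ) (M a : Fin N → ℝ) (T δ V C₁ C₂ ρ₀ κ : ℝ) (ξ : Fin N → ℝ → EuclideanSpace ℝ (Fin 3)) (β : ℝ → ℝ) (U₀ : TopologicalSpace.Opens Literature.Geometry.Lorentzian.E4) (B₀ :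 Literature.Geometry.Lorentzian.ModelBackground) (B : Fin N → Literature.Geometry.Lorentzian.ModelBackground) (Ψ₀ : B₀.domain → 𝒟.carrier) (Ψ : (i : Fin N) → (B i).domain → 𝒟.carrier) (O : Set 𝒟.carrier) (T₁ : ℝ) (ρ : ℝ → ℝ) (R : Fin N → ℝ → ℝ) (U₁ : TopologicalSpace.Opens Literature.Geometry.Lorentzian.E4) (Φ₀ : (Literature.Geometry.Lorentzian.Minkowski.backgroundOn U₁).domain → 𝒟.carrier), 𝒟.toCauchyDevelopment.IsFinalEra₂ N M a T δ V C₁ C₂ ρ₀ κ ξ β U₀ B₀ B Ψ₀ Ψ O → IsRestFrameSettledOn 𝒟.toCauchyDevelopment N M a T₁ ξ B Ψ O U₁ Φ₀ ρ R → Summit.FinalStateConjecture.RaysStayInClosure 𝒟.toCauchyDevelopment O → (∀ i (ρ' : ℝ), ∀ᶠ τ in Filter.atTop, ∀ x ∈ (B i).truncTimeSlab ρ' τ, 𝒟.toSpacetime.timeOrientation.IsFutureDirected (mfderiv 𝓘(ℝ, Literature.Geometry.Lorentzian.E4) (𝓡 4) (Ψ i) x (Literature.Geometry.Lorentzian.Kerr.timeVector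 (M i) (a i) x.1))) → (∀ i j, i ≠ j → Filter.Tendsto (fun t ↦ ‖ξ i t - ξ j t‖) Filter.atTop Filter.atTop) → (∀ i, ∃ v : EuclideanSpace ℝ (Fin 3), ‖v‖ ≤ V ∧ Filter.Tendsto (fun t : ℝ ↦ t⁻¹ • ξ i t) Filter.atTop (nhds v)) → ∃ (O' : Set 𝒟.carrier) (d : Literature.Geometry.Lorentzian.FinalStateDecomposition 𝒟.toSpacetime O' 2), (∀ i, Literature.Geometry.Lorentzian.Kerr.IsSubextremal (d.mass i) (d.spin i)) ∧ O' = Summit.FinalStateConjecture.exteriorOf 𝒟.toCauchyDevelopment d.charted ∧ Summit.FinalStateConjecture.RaysStayInClosure 𝒟.toCauchyDevelopment O' ∧ Summit.FinalStateConjecture.HasExhaustiveCharts d ∧ Summit.FinalStateConjecture.IsFutureOriented d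

/-- `DispersingCapture₅c` HOLDS (landed `captureOfSettled_of_cesaro`, p154603). -/
theorem dispersingCapture₅c_holds : DispersingCapture₅c := by
  intro X _ _ _ _ _ _ D _hD 𝒟 _hmax _hscri N M a T δ V C₁ C₂ ρ₀ κ ξ β U₀ B₀ B Ψ₀ Ψ O T₁ ρ R U₁ Φ₀ hera hset hrays
    hholes hdisp hvel
  obtain ⟨hΦ₀, hΨ, hS1, hS2, hS3, hS4, hS5, hO, hS6, hS7⟩ := hset
  exact captureOfSettled_of_cesaro X D 𝒟 N M a T δ V C₁ C₂ ρ₀ κ ξ β U₀ B₀ B Ψ₀ Ψ O T₁ ρ R U₁ Φ₀ hera hΦ₀ hΨ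
    hS1 hS2 hS3 hS4 hS5 hO hS6 hS7 hrays hholes hdisp hvel

/-- **PROPOSED rev 4 (bare form, modulo E).** As `DispersingCapture₅` without the escape-rate hypothesis and WITH
the rev-3 far flat orientation (F₀) on `Ψ₀` (consumed by E). -/
def DispersingCapture₅e : Prop :=
  ∀ (X : Type) [TopologicalSpace X] [ChartedSpace (EuclideanSpace ℝ (Fin 3)) X] [IsManifold (𝓡 3) ((⊤ : ℕ∞) : WithTop ℕ∞) X] [T2Space X] [SecondCountableTopology X] [ConnectedSpace X], ∀ (D : Literature.Geometry.Lorentzian.InitialDataSet (𝓡 3) X), D ∈ Literature.Geometry.Lorentzian.admissibleVacuumData X → ∀ (𝒟 : Literature.Geometry.Lorentzian.VacuumCauchyDevelopment D), 𝒟.IsMaximal → Summit.FinalStateConjecture.HasCompleteNullInfinity 𝒟.toCauchyDevelopment → ∀ (N : ℕ) (M a : Fin N → ℝ) (T δ V C₁ C₂ ρ₀ κ : ℝ) (ξ : Fin N → ℝ → EuclideanSpace ℝ (Fin 3)) (β : ℝ → ℝ) (U₀ : TopologicalSpace.Opens Literature.Geometry.Lorentzian.E4) (B₀ : Literature.Geometry.Lorentzian.ModelBackground)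 (B : Fin N → Literature.Geometry.Lorentzian.ModelBackground) (Ψ₀ : B₀.domain → 𝒟.carrier) (Ψ : (i : Fin N) → (B i).domain → 𝒟.carrier) (O : Set 𝒟.carrier) (T₁ : ℝ) (ρ : ℝ → ℝ) (R : Fin N → ℝ → ℝ) (U₁ : TopologicalSpace.Opens Literature.Geometry.Lorentzian.E4) (Φ₀ : (Literature.Geometry.Lorentzian.Minkowski.backgroundOn U₁).domain → 𝒟.carrier), 𝒟.toCauchyDevelopment.IsFinalEra₂ N M a T δ V C₁ C₂ ρ₀ κ ξ β U₀ B₀ B Ψ₀ Ψ O → IsRestFrameSettledOn 𝒟.toCauchyDevelopment N M a T₁ ξ B Ψ O U₁ Φ₀ ρ R → Summit.FinalStateConjecture.RaysStayInClosure 𝒟.toCauchyDevelopment O → (∀ i (ρ' : ℝ), ∀ᶠ τ in Filter.atTop, ∀ x ∈ (B i).truncTimeSlab ρ' τ, 𝒟.toSpacetime.timeOrientation.IsFutureDirected (mfderiv 𝓘(ℝ, Literature.Geometry.Lorentzian.E4) (𝓡 4) (Ψ i) x (Literature.Geometry.Lorentzian.Kerr.timeVector (M i) (a i) x.1))) → (∃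 ϱ₀ : ℝ, ∀ᶠ τ in Filter.atTop, ∀ x ∈ B₀.timeSlab τ, (∀ i, ϱ₀ ≤ ‖Literature.Geometry.Lorentzian.E4.spatial x.1 - ξ i τ‖) → 𝒟.toSpacetime.timeOrientation.IsFutureDirected (mfderiv 𝓘(ℝ, Literature.Geometry.Lorentzian.E4) (𝓡 4) Ψ₀ x (Literature.Geometry.Lorentzian.E4.basisVector 0))) → (∀ i j, i ≠ j → Filter.Tendsto (fun t ↦ ‖ξ i t - ξ j t‖) Filter.atTop Filter.atTop) → ∃ (O' : Set 𝒟.carrier) (d : Literature.Geometry.Lorentzian.FinalStateDecomposition 𝒟.toSpacetime O' 2), (∀ i, Literature.Geometry.Lorentzian.Kerr.IsSubextremal (d.mass i) (d.spin i)) ∧ O' = Summit.FinalStateConjecture.exteriorOf 𝒟.toCauchyDevelopment d.charted ∧ Summit.FinalStateConjecture.RaysStayInClosure 𝒟.toCauchyDevelopment O' ∧ Summit.FinalStateConjecture.HasExhaustiveCharts d ∧ Summit.FinalStateConjecture.IsFutureOriented d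

/-- `DispersingCapture₅e` holds MODULO the GR input E (registered rev-3 form). -/
theorem dispersingCapture₅e_of_escapeRate : Sig.stub_escapeRate → DispersingCapture₅e := by
  intro hE X _ _ _ _ _ _ D hD 𝒟 hmax hscri N M a T δ V C₁ C₂ ρ₀ κ ξ β U₀ B₀ B Ψ₀ Ψ O T₁ ρ R U₁ Φ₀ hera hset hrays
    hholes hflat hdisp
  have hesc : ∀ i j, i ≠ j → IntegrableOn (fun t ↦ 1 / ‖ξ i t - ξ j t‖ ^ 2) (Ici T) :=
    hE X D hD 𝒟 hmax hscri N M a T δ V C₁ C₂ ρ₀ κ ξ β U₀ B₀ B Ψ₀ Ψ O hera hrays hholes hflat hdisp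
  obtain ⟨hΦ₀, hΨ, hS1, hS2, hS3, hS4, hS5, hO, hS6, hS7⟩ := hset
  exact stub_captureOfSettled X D 𝒟 N M a T δ V C₁ C₂ ρ₀ κ ξ β U₀ B₀ B Ψ₀ Ψ O T₁ ρ R U₁ Φ₀ hera hΦ₀ hΨ hS1
    hS2 hS3 hS4 hS5 hO hS6 hS7 hrays hholes hdisp hesc

end Summit.FinalStateConjecture.FinalStateConjecture.Cruxes.DispersingCapture.Restated3

end
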